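import Summits.HodgeConjecture.HodgeConjecture.Theses.RigidRelativesJacobianTorelli
import Summits.HodgeConjecture.HodgeConjecture.Theorems.Ring2AbelianAllAndreCorrespondenceCategory
import HarnessLib

/-!
# Crux `RelativesTate` (stmt-HodgeConjecture-18578), line `birth` — stub 4 `stub_algebraicComp`:
# composites of algebraic correspondences are algebraic

Route `HodgeConjecture/RigidRelativesJacobianTorelli`, crux `RelativesTate` (rank 2; "Galois ≤ algebraic", iso face);
registered skeleton `Cruxes/RelativesTate/Lines/birth.lean` (`RelativesTate_of : Sig.stub_kugaSatoAnchor →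
Sig.stub_algebraicLeftInverse → Sig.stub_kugaSatoTransit → Sig.stub_algebraicComp → RelativesTate`). This file closes the
registered stub

* **`stub_algebraicComp`** (signature VERBATIM; Fulton Def. 16.1.1 / Prop. 16.1.2 (a), Voisin II Prop. 9.17 with
  Props. 9.20–9.21): for smooth projective complex `X, Y, Z` of dimensions `l, m, n` and `T₁ : Hᵃ(X(ℂ); ℂ) → Hᵇ(Y(ℂ); ℂ)`,
  `T₂ : Hᵇ(Y(ℂ); ℂ) → Hᶜ(Z(ℂ); ℂ)` induced by algebraic classes on `Y × X`, `Z × Y`, with the degree guard `a ≤ 2 dim X`,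
  the composite `T₂ ∘ T₁` is induced by an algebraic class on `Z × X`.

At registration (2026-08-17) the tree had no composition lemma for `IsAlgebraicCorrespondence` on the real carriers; it
has one since: part XXII-e of the AbelianAll André axis (`Ring2AbelianAllAndreCorrespondenceCategory`,
`IsAlgebraicCorrespondence.comp` — normalisation of both witnesses to the complex orientations, then Fulton 16.1.1 with the
tree's Gysin base change, `corrAction_comp`). The stub is that theorem with the binders permuted; its degree proviso
`a ≤ c + 2 dim X` follows from the guard `a ≤ 2 dim X`.

Nothing here is a case of the Hodge or Tate conjectures; no definition, no named fact, no sorry.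
References: [Fulton1998] §16.1 Def. 16.1.1–16.1.2, Prop. 16.1.1; [VoisinHodgeII2003] §9.2 Prop. 9.17, (9.9),
Props. 9.20–9.21; [Kleiman1968AlgebraicCycles] §1.3; [Andre1996Motifs] §2.1 (p. 14).
-/

noncomputable section

-- every declaration of this problem lives in `Summit.HodgeConjecture.HodgeConjecture.…` (summit = sub-problem)
set_option linter.dupNamespace false

open CategoryTheory AlgebraicGeometry
open Literature.AlgebraicGeometry.Motives Literature.AlgebraicGeometry.HodgeTheory
open Summit.HodgeConjecture.HodgeConjecture.Ring2.AbelianAll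

namespace Summit.HodgeConjecture.HodgeConjecture.Theorems.RelativesTate

/-- **Stub `stub_algebraicComp` of crux `RelativesTate` (registered signature, verbatim): composites of algebraic
correspondences between smooth projective complex varieties are algebraic correspondences** (`a ≤ 2 dim X`):
`[Γ₂ ∘ Γ₁]_* = [Γ₂]_* ∘ [Γ₁]_*` with `Γ₂ ∘ Γ₁ = p_{ZX*}(p_{ZY}^* Γ₂ · p_{YX}^* Γ₁)`, an algebraic class on `Z × X`
(the tree's `IsAlgebraicCorrespondence.comp`). [cite: Fulton1998, §16.1 Def. 16.1.1 and Prop. 16.1.1]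
[cite: VoisinHodgeII2003, §9.2 Prop. 9.17 and Props. 9.20–9.21] [cite: Andre1996Motifs, §2.1 (p. 14)] -/
theorem stub_algebraicComp :
    ∀ ⦃l m n : ℕ⦄ ⦃X Y Z : SchemeOver.{0} ℂ⦄,
      IsSmoothProjective l X → IsSmoothProjective m Y → IsSmoothProjective n Z →
      ∀ ⦃a b c : ℕ⦄ (T₁ : complexBetti X a →ₗ[ℂ] complexBetti Y b)
        (T₂ : complexBetti Y b →ₗ[ℂ] complexBetti Z c), a ≤ 2 * l →
        IsAlgebraicCorrespondence m l Y X T₁ → IsAlgebraicCorrespondence n m Z Y T₂ →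
          IsAlgebraicCorrespondence n l Z X (T₂ ∘ₗ T₁) :=
  fun _ _ _ _ _ _ hX hY hZ _ _ _ _ _ ha h₁ h₂ ↦ IsAlgebraicCorrespondence.comp hZ hY hX h₁ h₂ (by omega)

/-- **Corollary (the shape used twice by `RelativesTate_of`)**: composites of algebraic correspondences on `H³` between
smooth projective complex threefolds are algebraic. [cite: Fulton1998, §16.1 Prop. 16.1.1] -/
theorem isAlgebraicCorrespondence_comp_three {X Y Z : SchemeOver.{0} ℂ} (hX : IsSmoothProjective 3 X)
    (hY : IsSmoothProjective 3 Y) (hZ : IsSmoothProjective 3 Z) {T₁ : complexBetti X 3 →ₗ[ℂ] complexBetti Y 3}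
    {T₂ : complexBetti Y 3 →ₗ[ℂ] complexBetti Z 3} (h₁ : IsAlgebraicCorrespondence 3 3 Y X T₁)
    (h₂ : IsAlgebraicCorrespondence 3 3 Z Y T₂) : IsAlgebraicCorrespondence 3 3 Z X (T₂ ∘ₗ T₁) :=
  stub_algebraicComp hX hY hZ T₁ T₂ (by omega) h₁ h₂

end Summit.HodgeConjecture.HodgeConjecture.Theorems.RelativesTate

end
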